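import Literature.AnabelianGeometry.EtaleTheta.KummerDataOfCore
import Literature.AnabelianGeometry.EtaleTheta.TemperedRigidity
import Literature.AnabelianGeometry.EtaleTheta.ThetaLiftUnique
import HarnessLib

/-!
# [EtTh] Thm. 1.6 (ii), junction link (J1b): TRANSPORT OF KUMMER CLASSES OF A KUMMER CORE along `(γ, γ^Θ)` —
# the cocycle-level «functoriality of the Kummer map» for `ThetaSetting.KummerCore` (proof-only)

S. Mochizuki, *The étale theta function and its Frobenioid-theoretic manifestations*, Publ. RIMS **45** (2009), §1,
Thm. 1.6 (ii) p. 24 (printed 250): "`γ` induces an isomorphism `(Δ_Θ)α →̃ (Δ_Θ)β` that is compatible with the surjections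
`H¹(G_{K̈α}, (Δ_Θ)α) →̃ H¹(G_{K̈α}, Ẑ(1)) →̃ (K̈^×_α)^∧ ↠ Ẑ` …" [cite: MochizukiEtTh2009, Thm 1.6 (ii) p.24]; proof p. 250
l. 82–83: "The asserted compatibility then follows from [SemiAnbd], Theorem 6.12; [AbsAnab], Proposition 1.2.1, (iv),
(vi), (vii)". Layer L2 of the abc-iut cell, seat abc-iut-L2-t1 (gen 12; abc-iut-L2-lead R1194/R1221 «T16II-HV», FILE 1 of 2,
sizing memo HOME/staging/L2/L2-t1g12/SIZING-T16ii-hV-J1-L2t1-g12.md). PROOF-ONLY (no `def`, no instance, no `Prop`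
fact) over abc-iut-w5-d171's `ThetaSetting.KummerCore` / `KummerCore.toKummerData` (`KummerDataOfCore.lean`: the Kummer
data whose Kummer maps ARE the tree's continuous Kummer map `CyclotomeCoefficients.kummerContMap` with coefficients
`coeffHom : Λ(ℚ̄_p^×) ≅ Δ_Θ`, `KddHat := (ℚ̄_p^×)^{(Π^tp_Ÿ)^Θ} = K̈^×`) and this seat's `ThetaSetting.transport` (Thm. 1.6 (iii),
`TemperedRigidity.lean`) — consumed BY NAME.

THE LINK. For theta settings `Dα`, `Dβ`, an isomorphism `γ : Π^tp_{Xα} →̃ Π^tp_{Xβ}` with Thm. 1.6 (i) `h` and a theta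
companion `c` (`γ^Θ`), Kummer CORES `Cα`, `Cβ`, and a multiplicative bijection `ψ : ℚ̄_p^× →̃ ℚ̄_p^×` ([AbsAnab] Prop. 1.2.1
(vii)'s `ψ̄ : K̄₁^× →̃ K̄₂^×`, moved to `ℚ̄_p`) which is
* **`γ`-EQUIVARIANT on `Π^tp_{Ÿα}`** (`hψG`): `ψ(aug_α(y) · x) = aug_β(γ y) · ψ(x)` — [AbsAnab] 1.2.1 (vi) "Galois-equivariant
  with respect to `α`", `α` = the isomorphism `G_{K̈α} →̃ G_{K̈β}` induced by `γ`, stated through `γ` and the augmentations;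
* **COMPATIBLE WITH THE CYCLOTOMES** (`hΘι`): `γ^Θ(coeffHom_α(ζ)) = coeffHom_β(Λψ(ζ))` for `ζ ∈ Λ(ℚ̄_p^×) = Ẑ(1)` — the
  CYCLOTOMIC-RIGIDITY JUNCTION ([SemiAnbd] Thm. 6.12 read on `Δ_Θ` through the cores' `Ẑ(1) ≅ Δ_Θ`; a HYPOTHESIS here),
we PROVE:
* `KummerCore.map_mem_invYdd` — `ψ` carries `K̈α^× = (ℚ̄_p^×)^{(Π^tp_{Ÿα})^Θ}` into `K̈β^×` (from `hψG` and Thm. 1.6 (i));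
* **`KummerCore.transport_inflTheta_kumYdd`** — "the isomorphism of cohomology groups induced by `γ`" carries the Kummer class
  of `a ∈ K̈α^×` to the Kummer class of `ψ a`:
  `transport c h (infl κ̈_α(a)) = infl κ̈_β(ψ a)` in `H¹(Π^tp_{Ÿβ}, (Δ_Θ)β)` — on cocycles: `γ^Θ(coeffHom_α((σ·x_n/x_n)_n))
  = coeffHom_β((ψ(σ·x_n)/ψ(x_n))_n)` with `σ = aug_α(γ⁻¹ y′)`, and `ψ(x_n)` is a compatible root system of `ψ(a)`
  (`RootSystem.map`), the class being independent of the root system (`kummerContMap_apply_eq`);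
* `KummerCore.transport_eq_of_eq_kumYdd` — hence ANY `δ : K̈α^× → K̈β^×` satisfying the transport equation of Thm. 1.6 (ii)(a)
  agrees with `ψ` on `K̈α^×` (injectivity of `infl ∘ κ̈_β`: `kumYdd_injective` + `inflTheta_injective`).
FILE 2 (`Sec1Thm16iiHVOfUnitsTransport`) supplies `ψ` from abc-iut-L4's PROVED [AbsAnab] Prop. 1.2.1 (vii)
(`Prop121vii.unitsTransport_holds`) and derives the `hV` binder of `Thm16Sub.thm16ii_of_prop15ii` for cores modulo `hΘι`.
HONEST FRAMING: statements about the typed interface; `hΘι` is an explicit hypothesis (no constructor in the tree);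
nothing of [EtTh] is asserted; no side is taken on [IUTchIII] Cor. 3.12; typed ≠ proved.
-/

noncomputable section

namespace Literature.AnabelianGeometry.EtaleTheta

open Literature.AnabelianGeometry.SemiGraphs
open scoped IsMulCommutative

namespace ThetaSetting.KummerCore

variable {p : ℕ} [Fact p.Prime] {Dα Dβ : ThetaSetting p} {γ : Dα.PiTemp ≃ₜ* Dβ.PiTemp}

/-! ### `ψ` carries `K̈α^×` into `K̈β^×` -/

/-- `aug^Θ ∘ (·)^Θ = aug` on `Π^tp_Ÿ`, membership form: for `g ∈ (Π^tp_Ÿ)^Θ` there is `y ∈ Π^tp_Ÿ` with `g = θ(y)` and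
`aug^Θ g = aug y`. [cite: MochizukiEtTh2009, Prop 1.5 p.23] -/
theorem exists_eq_toTheta_of_mem_map (C : Dα.KummerCore) {g : Dα.GtpTheta}
    (hg : g ∈ Dα.GtpYdd.map Dα.toTheta) : ∃ y ∈ Dα.GtpYdd, Dα.toTheta y = g ∧ C.augTheta g = Dα.aug y := by
  obtain ⟨y, hy, rfl⟩ := hg
  exact ⟨y, hy, rfl, C.augTheta_toTheta y⟩

/-- **`ψ(K̈α^×) ⊆ K̈β^×`**: a `γ`-equivariant `ψ` carries the `(Π^tp_{Ÿα})^Θ`-invariant units into the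
`(Π^tp_{Ÿβ})^Θ`-invariant units (Thm. 1.6 (i): `γ(Π^tp_{Ÿα}) = Π^tp_{Ÿβ}`). [cite: MochizukiEtTh2009, Thm 1.6 (ii) p.24] -/
theorem map_mem_invYdd (h : Thm16i γ) (Cα : Dα.KummerCore) (Cβ : Dβ.KummerCore)
    (ψ : (PadicAlgCl p)ˣ ≃* (PadicAlgCl p)ˣ)
    (hψG : ∀ y ∈ Dα.GtpYdd, ∀ x : (PadicAlgCl p)ˣ, ψ (Dα.aug y • x) = Dβ.aug (γ y) • ψ x)
    {a : (PadicAlgCl p)ˣ} (ha : a ∈ Cα.invYdd) : ψ a ∈ Cβ.invYdd := by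
  rw [KummerCore.mem_invariants_iff] at ha ⊢
  rintro σ ⟨g, hg, rfl⟩
  obtain ⟨y', hy', rfl⟩ := hg
  -- `y' = γ y` with `y ∈ Π^tp_{Ÿα}`
  have hy : γ.toMulEquiv.symm y' ∈ Dα.GtpYdd := symm_mem_GtpYdd h ⟨y', hy'⟩
  have hyy : γ (γ.toMulEquiv.symm y') = y' := γ.toMulEquiv.apply_symm_apply y'
  rw [Cβ.augTheta_toTheta, ← hyy]
  change Dβ.aug (γ (γ.toMulEquiv.symm y')) • ψ a = ψ a
  rw [← hψG _ hy a, ha _ ⟨Dα.toTheta (γ.toMulEquiv.symm y'), ⟨_, hy, rfl⟩, Cα.augTheta_toTheta _⟩]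

/-! ### The transport of a Kummer class is the Kummer class of `ψ a` -/

/-- **Transport of the Kummer classes of a core** (Thm. 1.6 (ii)(a) for cores, cocycle level): for `a ∈ K̈α^×`,
`transport c h (infl κ̈_α(a)) = infl κ̈_β(ψ a)` — "the isomorphism `H¹(G_{K̈α}, (Δ_Θ)α) →̃ H¹(G_{K̈β}, (Δ_Θ)β)` induced by `γ`"
IS, on Kummer classes, the map `ψ` ([AbsAnab] Prop. 1.2.1 (vii): "the natural isomorphisms `H¹(Kᵢ, μ) ≅ (Kᵢ^×)^∧` … are
compatible"), GIVEN the `γ`-equivariance of `ψ` and the cyclotome compatibility `hΘι`.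
[cite: MochizukiEtTh2009, Thm 1.6 (ii) p.24] -/
theorem transport_inflTheta_kumYdd (h : Thm16i γ) (c : ThetaCompanion γ) (Cα : Dα.KummerCore) (Cβ : Dβ.KummerCore)
    (ψ : (PadicAlgCl p)ˣ ≃* (PadicAlgCl p)ˣ)
    (hψG : ∀ y ∈ Dα.GtpYdd, ∀ x : (PadicAlgCl p)ˣ, ψ (Dα.aug y • x) = Dβ.aug (γ y) • ψ x)
    (hΘι : ∀ ζ : cyclotome (PadicAlgCl p)ˣ,
      c.thetaIso (Cα.coeffHom ζ : Dα.GtpTheta) = (Cβ.coeffHom (cyclotome.map (ψ : (PadicAlgCl p)ˣ →* (PadicAlgCl p)ˣ) ζ) : Dβ.GtpTheta))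
    (a : Cα.invYdd) :
    transport c h (Dα.inflTheta Dα.GtpYdd (Cα.toKummerData.kumYdd a)) =
      Dβ.inflTheta Dβ.GtpYdd (Cβ.toKummerData.kumYdd ⟨ψ a, map_mem_invYdd h Cα Cβ ψ hψG a.2⟩) := by
  letI := Dα.unitsAction Cα.augTheta
  letI := Dβ.unitsAction Cβ.augTheta
  -- a compatible root system of `a` and its image, a compatible root system of `ψ a`
  obtain ⟨x⟩ := (inferInstance : Nonempty (RootSystem (a : (PadicAlgCl p)ˣ)))
  have hL : Cα.toKummerData.kumYdd a =
      Cα.coeff.kummerContClass (Dα.GtpYdd.map Dα.toTheta) x a.2 (fun _ => Cα.isOpen_stabilizer' _) :=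
    Cα.coeff.kummerContMap_apply_eq (Dα.GtpYdd.map Dα.toTheta) Cα.isOpen_stabilizer' a x
  have hR : Cβ.toKummerData.kumYdd ⟨ψ a, map_mem_invYdd h Cα Cβ ψ hψG a.2⟩ =
      Cβ.coeff.kummerContClass (Dβ.GtpYdd.map Dβ.toTheta) (x.map (ψ : (PadicAlgCl p)ˣ →* (PadicAlgCl p)ˣ))
        (map_mem_invYdd h Cα Cβ ψ hψG a.2) (fun _ => Cβ.isOpen_stabilizer' _) :=
    Cβ.coeff.kummerContMap_apply_eq (Dβ.GtpYdd.map Dβ.toTheta) Cβ.isOpen_stabilizer'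
      ⟨ψ a, map_mem_invYdd h Cα Cβ ψ hψG a.2⟩ (x.map (ψ : (PadicAlgCl p)ˣ →* (PadicAlgCl p)ˣ))
  rw [hL, hR]
  -- both sides are classes of explicit cocycles on `Π^tp_{Ÿβ}`
  change ContH1.mk (transportFun c h fun y : ↥Dα.GtpYdd =>
      Cα.coeff.hom (x.kummerCocycle a.2 ⟨Dα.toTheta (y : Dα.PiTemp), ⟨(y : Dα.PiTemp), y.2, rfl⟩⟩)) _ =
    ContH1.mk (fun y' : ↥Dβ.GtpYdd => Cβ.coeff.hom ((x.map (ψ : (PadicAlgCl p)ˣ →* (PadicAlgCl p)ˣ)).kummerCocycle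
      (map_mem_invYdd h Cα Cβ ψ hψG a.2) ⟨Dβ.toTheta (y' : Dβ.PiTemp), ⟨(y' : Dβ.PiTemp), y'.2, rfl⟩⟩)) _
  refine ContH1.mk_congr _ (funext fun y' => Subtype.ext ?_) _ _
  have hy : γ.toMulEquiv.symm (y' : Dβ.PiTemp) ∈ Dα.GtpYdd := symm_mem_GtpYdd h y'
  have hyy : γ (γ.toMulEquiv.symm (y' : Dβ.PiTemp)) = y' := γ.toMulEquiv.apply_symm_apply _
  change c.thetaIso ((Cα.coeffHom (x.kummerCocycle a.2
      ⟨Dα.toTheta (γ.toMulEquiv.symm (y' : Dβ.PiTemp)), ⟨_, hy, rfl⟩⟩) : Dα.GtpTheta)) =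
    ((Cβ.coeffHom ((x.map (ψ : (PadicAlgCl p)ˣ →* (PadicAlgCl p)ˣ)).kummerCocycle (map_mem_invYdd h Cα Cβ ψ hψG a.2)
      ⟨Dβ.toTheta (y' : Dβ.PiTemp), ⟨(y' : Dβ.PiTemp), y'.2, rfl⟩⟩)) : Dβ.GtpTheta)
  rw [hΘι]
  congr 2
  refine Subtype.ext (funext fun n => ?_)
  rw [cyclotome.map_apply, RootSystem.kummerCocycle_apply, RootSystem.kummerCocycle_apply, RootSystem.map_root]
  change ψ (Cα.augTheta (Dα.toTheta (γ.toMulEquiv.symm (y' : Dβ.PiTemp))) • x.root n / x.root n) =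
    Cβ.augTheta (Dβ.toTheta (y' : Dβ.PiTemp)) • ψ (x.root n) / ψ (x.root n)
  rw [Cα.augTheta_toTheta, Cβ.augTheta_toTheta, map_div, hψG _ hy, hyy]

/-- **Uniqueness of the induced map on `K̈^×`**: if `δ : K̈α^× → K̈β^×` satisfies the transport equation of Thm. 1.6 (ii)(a)
(`transport c h (infl κ̈_α(a)) = infl κ̈_β(δ a)` for all `a`), then `δ a = ψ a` — `infl ∘ κ̈_β` is injective on the core
(`KummerData.kumYdd_injective` of `KummerCore.toKummerData` and abc-iut-L2-t12's `ThetaSetting.inflTheta_injective`).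
[cite: MochizukiEtTh2009, Thm 1.6 (ii) p.24] -/
theorem transport_eq_of_eq_kumYdd (h : Thm16i γ) (c : ThetaCompanion γ) (Cα : Dα.KummerCore) (Cβ : Dβ.KummerCore)
    (ψ : (PadicAlgCl p)ˣ ≃* (PadicAlgCl p)ˣ)
    (hψG : ∀ y ∈ Dα.GtpYdd, ∀ x : (PadicAlgCl p)ˣ, ψ (Dα.aug y • x) = Dβ.aug (γ y) • ψ x)
    (hΘι : ∀ ζ : cyclotome (PadicAlgCl p)ˣ,
      c.thetaIso (Cα.coeffHom ζ : Dα.GtpTheta) = (Cβ.coeffHom (cyclotome.map (ψ : (PadicAlgCl p)ˣ →* (PadicAlgCl p)ˣ) ζ) : Dβ.GtpTheta))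
    (δ : Cα.invYdd → Cβ.invYdd)
    (hδ : ∀ a, transport c h (Dα.inflTheta Dα.GtpYdd (Cα.toKummerData.kumYdd a)) =
      Dβ.inflTheta Dβ.GtpYdd (Cβ.toKummerData.kumYdd (δ a)))
    (a : Cα.invYdd) :
    ((δ a : Cβ.invYdd) : (PadicAlgCl p)ˣ) = ψ a := by
  have key := (hδ a).symm.trans (transport_inflTheta_kumYdd h c Cα Cβ ψ hψG hΘι a)
  have := Cβ.toKummerData.kumYdd_injective (Dβ.inflTheta_injective Dβ.GtpYdd key)
  exact congrArg (fun u : Cβ.invYdd => (u : (PadicAlgCl p)ˣ)) this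

end ThetaSetting.KummerCore

end Literature.AnabelianGeometry.EtaleTheta

end
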